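import Summits.NavierStokesRegularity.NavierStokesRegularity.Theorems.ExtremiserTransienceBangBangCoreDefs
import Summits.NavierStokesRegularity.NavierStokesRegularity.Theorems.ExtremiserTransienceKStarAttainedPerturbation
import Literature.Analysis.FluidPDE.BiotSavartSupInterpolation
import Literature.Analysis.FluidPDE.BiotSavartRepresentationSqIntegrable
import HarnessLib

/-!
# Route `ExtremiserTransience`, crux `RegularisedNearPlateauStability` (stmt-NavierStokesRegularity-28317),
# LINE g6-γ «bang-bang core»: TWO TOOLS — the contact-part inequality and the cell-number lower bound

`--supports stmt-NavierStokesRegularity-28317` (helpers). Author: prover seat `ns-net-p2` (g0). Vocabulary: the landed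
`BangBang.{lam, ell, IsAdm, IsReg, IsDensity}` (`ExtremiserTransienceBangBangCoreDefs`) over `KStar.HalfSpace`.

* `ell_curl_le_of_density` (the K4 / contact-part inequality): if `G` is an Euler–Lagrange density of `v` with
  `‖G‖ ≤ Γ`, and the test potential `η` vanishes off a measurable set `T` of finite volume with `‖η‖ ≤ H`, then
  `ell_v(curl η) = ∫⟪G, η⟫ ≤ Γ·H·vol(T)`.
* `cellNumber_lower` (near-extremisers occupy at least `≍ 1/A₁` cells): for an admissible, `A`-regular,
  non-degenerate, `(κ⋆−ε)`-efficient field (`0 ≤ ε ≤ κ⋆`),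
  `π·(κ⋆−ε)³·M² ≤ 2κ⋆³·‖curlCLM‖·A₁ · (W·λ)`, i.e. the dimensionless cell number `N = λW/M²` is
  `≥ (π/2)(1−ε/κ⋆)³/(‖curlCLM‖A₁)`. Proof: Biot–Savart representation `v = K₃ ∗ ω` (tree
  `biotSavart_curl_eq_self_of_lintegral_sq_lt_top`) and the sup interpolation `‖K₃ ∗ ω‖_∞ ≤ 2(4π)^{-1/3}‖ω‖_∞^{1/3}Z^{1/3}`
  (tree `norm_biotSavart_le_rpow_third`) with `‖ω‖_∞ ≤ ‖curlCLM‖A₁M/λ`, against universality of `κ⋆` at the bound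
  `sup‖v‖` and near-efficiency at the bound `M`; then `Z = λ²W`.

Context: evidence note `K14-analysis.md` (items 28317 / 26567) — these are bricks of the GLOBAL bang-bang variant (§6 there);
the first is also the level-set-split step of the registered K14. HONEST FRAMING: elementary inequalities about one
functional; nothing about Navier–Stokes is proved; no summit is proved by a line. [folklore]
-/

noncomputable section

open MeasureTheory Set
open scoped InnerProductSpace RealInnerProductSpace ENNReal ContDiff
open Literature.Analysis.FluidPDE
open Summit.NavierStokesRegularity.NavierStokesRegularity.Theorems.DepletionLadder.KStar.HalfSpace

namespace Summit.NavierStokesRegularity.NavierStokesRegularity.Theorems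

-- the problem directory repeats the summit name (`NavierStokesRegularity/NavierStokesRegularity`)
set_option linter.dupNamespace false

namespace DepletionLadder.KStar.BangBang

variable {v : E3 → E3}

/-- **Contact-part inequality.** If `G` is an Euler–Lagrange density of `v` at level `M` with `‖G‖ ≤ Γ`, and the
test potential `η ∈ C_c^∞` vanishes off a measurable set `T` of finite volume and `‖η‖ ≤ H`, then
`ell_v(curl η) ≤ Γ·H·vol(T)`. [folklore] -/
theorem ell_curl_le_of_density {G η : E3 → E3} {M Γ H : ℝ} (hG : IsDensity v M G) (hΓ : ∀ x, ‖G x‖ ≤ Γ)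
    (hη : ContDiff ℝ ∞ η) (hηc : HasCompactSupport η) {T : Set E3} (hT : MeasurableSet T) (hTfin : volume T ≠ ⊤)
    (hηT : ∀ x, x ∉ T → η x = 0) (hH : ∀ x, ‖η x‖ ≤ H) :
    ell v M (curl η) ≤ Γ * H * (volume T).toReal := by
  rw [hG.2 η hη hηc]
  have hint : Integrable (fun x => ⟪G x, η x⟫_ℝ) (volume : Measure E3) :=
    integrable_inner_of_hasCompactSupport_right hG.1 hη.continuous hηc
  have hind : Integrable (T.indicator fun _ => Γ * H) (volume : Measure E3) :=
    (integrableOn_const (hs := hTfin)).integrable_indicator hT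
  calc ∫ x, ⟪G x, η x⟫_ℝ ≤ ∫ x, T.indicator (fun _ => Γ * H) x := by
        refine integral_mono hint hind fun x => ?_
        by_cases hx : x ∈ T
        · rw [indicator_of_mem hx]
          calc ⟪G x, η x⟫_ℝ ≤ ‖G x‖ * ‖η x‖ := real_inner_le_norm _ _
            _ ≤ Γ * H := mul_le_mul (hΓ x) (hH x) (norm_nonneg _) ((norm_nonneg _).trans (hΓ x))
        · rw [indicator_of_notMem hx, hηT x hx, inner_zero_right]
    _ = Γ * H * (volume T).toReal := by
        rw [integral_indicator_const _ hT, smul_eq_mul, Measure.real, mul_comm]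

/-- **Cell-number lower bound.** For an admissible, `A`-regular, non-degenerate field that is `(κ⋆−ε)`-efficient
(`0 ≤ ε ≤ κ⋆`): `π·(κ⋆−ε)³·M² ≤ 2κ⋆³·‖curlCLM‖·A₁·(W·λ)` — the dimensionless cell number `λW/M²` is bounded below by
`(π/2)(1 − ε/κ⋆)³/(‖curlCLM‖·A₁)` (Biot–Savart sup interpolation + universality of `κ⋆`). [folklore] -/
theorem cellNumber_lower {A : ℕ → ℝ} {M B ε : ℝ} (hadm : IsAdm v M B) (hreg : IsReg A v M)
    (hpos : 0 < M * Real.sqrt (Zen v) * Real.sqrt (Wpa v)) (hε : ε ≤ kStar)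
    (heff : (kStar - ε) * M * Real.sqrt (Zen v) * Real.sqrt (Wpa v) ≤ |Jst v|) :
    Real.pi * (kStar - ε) ^ 3 * M ^ 2 ≤ 2 * kStar ^ 3 * ‖curlCLM‖ * A 1 * (Wpa v * lam v) := by
  obtain ⟨hv, hdiv, hM, hB, h0, h1, h2⟩ := hadm
  -- non-degeneracy
  have hZ0 : 0 ≤ Zen v := integral_nonneg fun x => by positivity
  have hW0 : 0 ≤ Wpa v := integral_nonneg fun x => frobeniusNormSq_nonneg _
  have hMpos : 0 < M := by
    by_contra h
    exact absurd hpos (not_lt.2 (mul_nonpos_of_nonpos_of_nonneg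
      (mul_nonpos_of_nonpos_of_nonneg (not_lt.1 h) (Real.sqrt_nonneg _)) (Real.sqrt_nonneg _)))
  have hsZpos : 0 < Real.sqrt (Zen v) :=
    lt_of_le_of_ne (Real.sqrt_nonneg _) fun h => by rw [← h] at hpos; simp at hpos
  have hsWpos : 0 < Real.sqrt (Wpa v) :=
    lt_of_le_of_ne (Real.sqrt_nonneg _) fun h => by rw [← h] at hpos; simp at hpos
  have hZpos : 0 < Zen v := Real.sqrt_pos.1 hsZpos
  have hWpos : 0 < Wpa v := Real.sqrt_pos.1 hsWpos
  have hlampos : 0 < lam v := Real.sqrt_pos.2 (div_pos hZpos hWpos)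
  have hZeq : Zen v = lam v ^ 2 * Wpa v := by
    have h := Real.sq_sqrt (div_nonneg hZ0 hW0)
    rw [show Real.sqrt (Zen v / Wpa v) = lam v from rfl] at h
    rw [h, div_mul_cancel₀ _ hWpos.ne']
  have hk0 : 0 < kStar := kStar_pos
  have hkε : 0 ≤ kStar - ε := by linarith
  -- `‖ω‖ ≤ ‖curlCLM‖ A₁ M / λ`
  set c : ℝ := ‖curlCLM‖ with hcdef
  have hc0 : 0 ≤ c := norm_nonneg curlCLM
  set Mω : ℝ := c * (A 1 * M * (lam v)⁻¹) with hMω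
  have hω : ∀ y, ‖curl v y‖ ≤ Mω := fun y => by
    have h := norm_iteratedFDeriv_curl_le_opNorm_mul (N := ⊤) hv 0 le_top y
    rw [norm_iteratedFDeriv_zero] at h
    refine h.trans (mul_le_mul_of_nonneg_left ?_ hc0)
    simpa using hreg 1 y
  have hMω0 : 0 ≤ Mω := (norm_nonneg _).trans (hω 0)
  -- Biot–Savart: `‖v x‖ ≤ m₀ := 2 (4π)^{-1/3} Mω^{1/3} Z^{1/3}`
  have hωc : Continuous (curl v) := continuous_curl (hv.of_le (by norm_cast))
  have hZi : Integrable (fun y => ‖curl v y‖ ^ 2) :=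
    integrable_sq_norm_of_lintegral_lt_top hωc (lintegral_enorm_curl_sq_lt_top hv h1)
  have hv2 : ∫⁻ y, ‖v y‖ₑ ^ 2 < ⊤ := by
    have : (fun y => ‖v y‖ₑ ^ 2) = fun y => ‖iteratedFDeriv ℝ 0 v y‖ₑ ^ 2 := by
      funext y; rw [← ofReal_norm, ← ofReal_norm, norm_iteratedFDeriv_zero]
    rw [this]; exact h0
  have hrep : biotSavart (curl v) = v :=
    biotSavart_curl_eq_self_of_lintegral_sq_lt_top (hv.of_le (by norm_cast)) hdiv hv2
      (lintegral_enorm_curl_sq_lt_top hv h1)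
  set m₀ : ℝ := 2 * ((4 * Real.pi)⁻¹) ^ (1 / 3 : ℝ) * Mω ^ (1 / 3 : ℝ) * (Zen v) ^ (1 / 3 : ℝ) with hm₀
  have hvm : ∀ x, ‖v x‖ ≤ m₀ := fun x => by
    have h := norm_biotSavart_le_rpow_third hωc.aestronglyMeasurable hω hZi x
    rwa [hrep] at h
  have hm₀0 : 0 ≤ m₀ := (norm_nonneg _).trans (hvm 0)
  -- universality at the bound `m₀`, efficiency at the bound `M`
  have hJ : |Jst v| ≤ kStar * m₀ * Real.sqrt (Zen v) * Real.sqrt (Wpa v) :=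
    sharpDepletion_is_universal v m₀ B hv hdiv hvm hB h0 h1 h2
  have hMm : (kStar - ε) * M ≤ kStar * m₀ := by
    have h := heff.trans hJ
    have hD : 0 < Real.sqrt (Zen v) * Real.sqrt (Wpa v) := mul_pos hsZpos hsWpos
    have h' : (kStar - ε) * M * (Real.sqrt (Zen v) * Real.sqrt (Wpa v)) ≤
        kStar * m₀ * (Real.sqrt (Zen v) * Real.sqrt (Wpa v)) := by
      simpa only [mul_assoc] using h
    exact le_of_mul_le_mul_right h' hD
  -- cube: `m₀³ = 8 (4π)⁻¹ Mω Z`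
  have h13 : (1 / 3 : ℝ) = ((3 : ℕ) : ℝ)⁻¹ := by norm_num
  have hcube : ∀ {x : ℝ}, 0 ≤ x → (x ^ (1 / 3 : ℝ)) ^ 3 = x := fun hx => by
    rw [h13]; exact Real.rpow_inv_natCast_pow hx three_ne_zero
  have hm₀3 : m₀ ^ 3 = 8 * (4 * Real.pi)⁻¹ * Mω * Zen v := by
    rw [hm₀, mul_pow, mul_pow, mul_pow, hcube (by positivity), hcube hMω0, hcube hZ0]
    norm_num
  have hcubed : ((kStar - ε) * M) ^ 3 ≤ (kStar * m₀) ^ 3 :=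
    pow_le_pow_left₀ (mul_nonneg hkε hMpos.le) hMm 3
  rw [mul_pow, mul_pow, hm₀3] at hcubed
  -- `Zen v = lam² W`, `Mω = c A₁ M / λ`; clear denominators
  have hlam : lam v ≠ 0 := hlampos.ne'
  have hπ : 0 < Real.pi := Real.pi_pos
  have key : (kStar - ε) ^ 3 * M ^ 3 * (4 * Real.pi) * lam v ≤
      kStar ^ 3 * 8 * (c * A 1 * M) * (lam v ^ 2 * Wpa v) := by
    have h4 : 0 < 4 * Real.pi := by positivity
    have e : kStar ^ 3 * (8 * (4 * Real.pi)⁻¹ * Mω * Zen v) * ((4 * Real.pi) * lam v) =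
        kStar ^ 3 * 8 * (c * A 1 * M) * (lam v ^ 2 * Wpa v) := by
      rw [hZeq, hMω]; field_simp
    have := mul_le_mul_of_nonneg_right hcubed (by positivity : (0 : ℝ) ≤ (4 * Real.pi) * lam v)
    rw [e] at this
    linarith
  -- divide by `4 M λ > 0`
  have hMl : 0 < M * lam v := mul_pos hMpos hlampos
  nlinarith [key, hMl, mul_pos hMl hMpos]

end DepletionLadder.KStar.BangBang

end Summit.NavierStokesRegularity.NavierStokesRegularity.Theorems

end
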